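import Summits.BirchSwinnertonDyer.BirchSwinnertonDyer.Theses.SemiOrdinaryEisensteinDescent
import Summits.BirchSwinnertonDyer.BirchSwinnertonDyer.Theorems.SemiOrdinaryEisensteinDescentWildSplitEisensteinInclusionAtThreeRankOneRestriction
import HarnessLib

/-!
# Route `SemiOrdinaryEisensteinDescent`, support item `EisensteinKernelAtThreeRestricted`
# (stmt-BirchSwinnertonDyer-24156): THE RESTRICTED KERNEL — published inputs → RESTRICTED Eisenstein
# inclusion `E′` → Kolyvagin upper bound → Waldspurger unit value → control → rank-zero twist →
# non-tower residual ⟹ the leaf `WAllExclAddWildRankOneSurj`, PROVED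

Cell `bsd-wall` (W-ALL, row 2·3@3 lane 3), width seat `bsd-wall-soed-p1-w3` (gen 4), 2026-08-28, on
the route pen's text (planner bsd-wall-pss3x g0, SOED edit of 2026-08-28T00:36:59Z: crux #2
`WildSplitEisensteinInclusionAtThree` (stmt-BirchSwinnertonDyer-20479) ↦ aside, replaced in `closes` by
crux #2′ `WildSplitEisensteinInclusionAtThreeRestricted` (stmt-BirchSwinnertonDyer-24155) and this
re-packed kernel). Closes the support item `EisensteinKernelAtThreeRestricted` of route
`route-BirchSwinnertonDyer-SemiOrdinaryEisensteinDescent`: the theorem below has LITERALLY the type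
`Summit.BirchSwinnertonDyer.BirchSwinnertonDyer.Theses.SemiOrdinaryEisensteinDescent.EisensteinKernelAtThreeRestricted`.

The proof is the item text's one line: the kernel re-run
`WildSplitEisensteinInclusionAtThreeRankOneRestriction.wAllExclAddWildRankOneSurj_of_restricted`
(width seat bsd-wall-soed-p1-w3 g2, p588074) — Jetchev–Skinner–Wan's §7.4 assembly at the wild split
prime `3` (bed-p3 g1's `semiOrdinaryEisensteinDescent_eisensteinKernelAtThree_proof` verbatim) with the
Eisenstein step fed by `E′`, whose extra binders `(H, ι, P)`, `L(E^{(d_K)},1) ≠ 0`, `P = y_K`,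
`¬ IsOfFinAddOrder P` are exactly the Friedberg–Hoffstein / Heegner-point data the kernel holds at
that step; its hypothesis `hE'` is the text of `WildSplitEisensteinInclusionAtThreeRestricted`
character for character, so the route decl unfolds onto it.

HONEST FRAMING: this closes a SUPPORT item (pure assembly); every crux of the route
(`WildSplitEisensteinInclusionAtThreeRestricted`, `WildKolyvaginUpperAtThree`,
`WildSplitWaldspurgerAtThree`, `WildSplitControlAtThree`, `WildRankZeroTwistAtThree`,
`WildRankOneSurjNonTowerAtThree`) and the published inputs are ANTECEDENTS of the statement proved;
`E′` itself has no engine in print (the leads' walls W1–W3 on line `birth` of crux E stand for `E′`).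
BSD is not proved for any curve by this file. No definition, no named fact, no `sorry`.

References: [JetchevSkinnerWan2017] §7.4.1 (arXiv:1512.06894 p. 30); [Castella2018] Thm. 2.3, §5;
[GrossZagier1986] Thm. I.(6.3); [FriedbergHoffstein1995] Thm. B.
-/

noncomputable section

set_option linter.dupNamespace false
set_option autoImplicit false

namespace Summit.BirchSwinnertonDyer.BirchSwinnertonDyer.Theorems

open Summit.BirchSwinnertonDyer.BirchSwinnertonDyer.Theses.SemiOrdinaryEisensteinDescent

/-- **Item `EisensteinKernelAtThreeRestricted` (stmt-BirchSwinnertonDyer-24156) of route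
`SemiOrdinaryEisensteinDescent` holds**: `PublishedInputsWildThree →
WildSplitEisensteinInclusionAtThreeRestricted → WildKolyvaginUpperAtThree → WildSplitWaldspurgerAtThree →
WildSplitControlAtThree → WildRankZeroTwistAtThree → WildRankOneSurjNonTowerAtThree ⟹
WAllExclAddWildRankOneSurj` — the route kernel (Jetchev–Skinner–Wan §7.4 at the wild split `3`,
Manin-robust, one-sided halves) re-run with the Eisenstein step fed by the RESTRICTED crux `E′` at the
Friedberg–Hoffstein field, i.e. `wAllExclAddWildRankOneSurj_of_restricted` (p588074) applied to the
item's antecedents in order. Every crux is an antecedent; BSD is not proved by this.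
[cite: JetchevSkinnerWan2017, §7.4.1 (arXiv:1512.06894 p. 30)] [cite: FriedbergHoffstein1995, Thm. B] -/
theorem semiOrdinaryEisensteinDescent_eisensteinKernelAtThreeRestricted_proof :
    EisensteinKernelAtThreeRestricted := by
  unfold EisensteinKernelAtThreeRestricted
  intro hF hE' hKo hV hC hZ hNT
  exact WildSplitEisensteinInclusionAtThreeRankOneRestriction.wAllExclAddWildRankOneSurj_of_restricted hF hE'
    hKo hV hC hZ hNT

end Summit.BirchSwinnertonDyer.BirchSwinnertonDyer.Theorems

end
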